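import Summits.AtomisticToContinuum.HydrodynamicLimit.Theorems.JParityClosureLocalSecondLawLedgerDefs
import Summits.AtomisticToContinuum.HydrodynamicLimit.Theorems.JParityClosureDensityCapGridUpgrade
import Summits.AtomisticToContinuum.HydrodynamicLimit.Theorems.JParityClosureParityInBandSmoothTest

/-!
# Uniform-in-`x` law of large numbers for the cone fields at `t = 0`
(stmt-AtomisticToContinuum-13081, line `exact-entropy-ledger-three-passivities`, sub-goal `initialLayer_uniformLLN`
of stub B `stub_initialLayer`)

Under the crux's `t = 0` tie `TendstoHydroFieldsAt … 0` (the weak LLN: convergence in probability of the empirical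
density / momentum / energy fields tested against each continuous `χ`) with continuous limit data `(ρ, u, θ)(0, ·)`,
the cone-mollified empirical fields `(ρ_r, m_r, e_r)(Φ₀ z, x)` (`rhoC`, `momC`, `kinC` of
`Theorems/LocalSecondLaw/Negative/Functional.lean`) are, at FIXED `r < r₀` and eventually in `N`, `ε`-close to
`(ρ, ρu, E)(0, x)` at EVERY centre `x ∈ 𝕋³` off an event of law-probability `≤ δ` (`initialLayer_uniformLLN`).

Proof (the finite-net upgrade, cf. `JParityClosureDensityCapGridUpgrade` for the density alone):
* the three cone fields are `3/(π r⁴)`-Lipschitz in the centre with constants `1`, `1/2 + e`, `e`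
  (`e = ⟨μ, |v|²/2⟩` the empirical kinetic energy): `empiricalFields_sub_le` with the two tests `b_r(·,x)`, `b_r(·,y)`
  and the kernel bound `gridUp_abs_cone_sub_cone_le`; `e` is tight by the `χ ≡ 1` energy tie;
* the data are uniformly continuous on the compact torus in the minimal-image distance (`initL_unifCont`), and the
  cone average of a continuous function is uniformly close to it for small `r` (`initL_coneAvg`: unit mass
  `densMod_integral_cone_eq_one` and support `densMod_cone_eq_zero` of the kernel);
* a finite `m`-net of `𝕋³` (`gridUp_euclidNet`), the weak LLN at the finitely many tests `b_r(·, y)`, a finite union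
  bound and `Tendsto ⇒ ∃ N₀`.

References: H. Spohn, *Large Scale Dynamics of Interacting Particles* (1991), Part I §3 (setting); C. Kipnis,
C. Landim, *Scaling Limits of Interacting Particle Systems* (1999), Ch. 4 (moduli of continuity as the route from
pointwise to uniform statements).
-/

noncomputable section

namespace Summit.AtomisticToContinuum.HydrodynamicLimit.Theorems.LocalSecondLawLedger

open scoped BigOperators Topology Classical MeasureTheory ENNReal InnerProductSpace
open Filter Set MeasureTheory
open Literature.MathematicalPhysics.KineticTheory
open Literature.Analysis.FluidPDE
open Summit.AtomisticToContinuum.HydrodynamicLimit.Theorems.LocalSecondLawNegative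

variable {N : ℕ}

/-! ## Generic tools -/

/-- Uniform continuity of a continuous function on the compact torus, in the minimal-image distance
(which dominates the sup-distance, `Torus.norm_sub_le_euclidDist_holds`). -/
theorem initL_unifCont {E : Type*} [SeminormedAddCommGroup E] {f : T3 → E} (hf : Continuous f) {ε : ℝ}
    (hε : 0 < ε) : ∃ δ : ℝ, 0 < δ ∧ ∀ x y : T3, Torus.euclidDist x y < δ → ‖f x - f y‖ < ε := by
  obtain ⟨δ, hδ, h⟩ :=
    Metric.uniformContinuous_iff.1 (CompactSpace.uniformContinuous_of_continuous hf) ε hε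
  refine ⟨δ, hδ, fun x y hxy => ?_⟩
  rw [← dist_eq_norm]
  exact h (lt_of_le_of_lt ((dist_eq_norm x y).trans_le (Torus.norm_sub_le_euclidDist_holds x y)) hxy)

/-- Chaining four closeness bounds (three `≤ ε/4`, one `< ε/4`). -/
theorem initL_chain {E : Type*} [SeminormedAddCommGroup E] {a b c d e : E} {ε : ℝ}
    (h1 : ‖a - b‖ ≤ ε / 4) (h2 : ‖b - c‖ ≤ ε / 4) (h3 : ‖c - d‖ ≤ ε / 4) (h4 : ‖d - e‖ < ε / 4) :
    ‖a - e‖ < ε := by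
  calc ‖a - e‖ = ‖(a - b) + (b - c) + (c - d) + (d - e)‖ := by congr 1; abel
    _ ≤ ‖(a - b) + (b - c) + (c - d)‖ + ‖d - e‖ := norm_add_le _ _
    _ ≤ ‖(a - b) + (b - c)‖ + ‖c - d‖ + ‖d - e‖ := by gcongr; exact norm_add_le _ _
    _ ≤ ‖a - b‖ + ‖b - c‖ + ‖c - d‖ + ‖d - e‖ := by gcongr; exact norm_add_le _ _
    _ < ε := by linarith

/-- Chaining four closeness bounds, real-valued version. -/
theorem initL_chain_abs {a b c d e ε : ℝ} (h1 : |a - b| ≤ ε / 4) (h2 : |b - c| ≤ ε / 4)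
    (h3 : |c - d| ≤ ε / 4) (h4 : |d - e| < ε / 4) : |a - e| < ε :=
  initL_chain (E := ℝ) h1 h2 h3 h4

/-! ## The cone kernel and the cone fields

The kernel `cone` of `LocalSecondLawNegative` is definitionally the kernel `DensityCapNegative.cone` of the crux
`DensityCap`, so the landed kernel facts (`densMod_*`, `gridUp_abs_cone_sub_cone_le`) apply verbatim (by `show`). -/

/-- **Cone averages approximate a continuous function uniformly**: if `‖f y - f x‖ ≤ ε` on the minimal-image
ball of radius `r ≤ 1/2` about `x`, then `‖∫ b_r(y,x) f(y) dy - f x‖ ≤ ε` (unit mass and support of the kernel). -/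
theorem initL_coneAvg {E : Type*} [NormedAddCommGroup E] [NormedSpace ℝ E] [CompleteSpace E]
    {f : T3 → E} (hf : Continuous f) {r ε : ℝ} (hr : 0 < r) (hr2 : r ≤ 1 / 2) (x : T3)
    (hε : ∀ y, Torus.euclidDist y x < r → ‖f y - f x‖ ≤ ε) :
    ‖(∫ y, cone r y x • f y) - f x‖ ≤ ε := by
  have hcc : Continuous fun y => cone r y x := densMod_continuous_cone r x
  have hmass : ∫ y, cone r y x = 1 := densMod_integral_cone_eq_one hr hr2 x
  have hi1 : Integrable (fun y => cone r y x • f y) := integrable_of_continuous_T3 (hcc.smul hf)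
  have hi2 : Integrable (fun y => cone r y x • f x) :=
    integrable_of_continuous_T3 (hcc.smul continuous_const)
  have h1 : ∫ y, cone r y x • f x = f x := by
    rw [integral_smul_const, hmass, one_smul]
  have key : (∫ y, cone r y x • f y) - f x = ∫ y, cone r y x • (f y - f x) := by
    simp_rw [smul_sub]
    rw [integral_sub hi1 hi2, h1]
  have hpt : ∀ y, ‖cone r y x • (f y - f x)‖ ≤ cone r y x * ε := fun y => by
    rw [norm_smul, Real.norm_eq_abs, abs_of_nonneg (cone_nonneg hr y x)]
    by_cases hyx : Torus.euclidDist y x < r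
    · exact mul_le_mul_of_nonneg_left (hε y hyx) (cone_nonneg hr y x)
    · rw [show cone r y x = 0 from densMod_cone_eq_zero hr (not_lt.1 hyx), zero_mul, zero_mul]
  rw [key]
  calc ‖∫ y, cone r y x • (f y - f x)‖ ≤ ∫ y, cone r y x * ε :=
        norm_integral_le_of_norm_le (integrable_of_continuous_T3 (hcc.mul continuous_const))
          (Eventually.of_forall hpt)
    _ = ε := by rw [integral_mul_const, hmass, one_mul]

/-- The mollified density is continuous in the centre. -/
theorem initL_continuous_rhoC (r : ℝ) (w : Phase N) : Continuous (rhoC r w) := by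
  have h : rhoC r w = fun x => ((N + 1 : ℕ) : ℝ)⁻¹ * ∑ i, cone r (w i).1 x := by
    funext x
    unfold rhoC
    rw [integral_empiricalMeasure]
  rw [h]
  exact continuous_const.mul (continuous_finsetSum _ fun i _ => continuous_cone r _)

/-- The mollified momentum is continuous in the centre. -/
theorem initL_continuous_momC (r : ℝ) (w : Phase N) : Continuous (momC r w) := by
  have h : momC r w = fun x => ((N + 1 : ℕ) : ℝ)⁻¹ • ∑ i, cone r (w i).1 x • (w i).2 := by
    funext x
    unfold momC
    rw [integral_empiricalMeasure_vec]
  rw [h]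
  exact (continuous_const (y := ((N + 1 : ℕ) : ℝ)⁻¹)).smul (continuous_finsetSum _ fun i _ =>
    (continuous_cone r (w i).1).smul (continuous_const (y := (w i).2)))

/-- The empirical kinetic energy `⟨μ_w, |v|²/2⟩` is non-negative. -/
theorem initL_energy_nonneg (w : Phase N) : 0 ≤ empiricalEnergyField w (fun _ => 1) := by
  unfold empiricalEnergyField
  rw [integral_empiricalMeasure]
  exact mul_nonneg (by positivity) (Finset.sum_nonneg fun i _ => mul_nonneg (by norm_num) (by positivity))

/-- **Centre-Lipschitz bounds of the three cone fields** (from `empiricalFields_sub_le` with the two test functions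
`b_r(·, x)`, `b_r(·, y)`, which are `3/(π r⁴) d(x, y)`-close): constants `1`, `1/2 + e`, `e` times `3/(π r⁴) d(x,y)`,
`e = ⟨μ_w, |v|²/2⟩` the empirical kinetic energy. -/
theorem initL_fields_lip {r : ℝ} (hr : 0 < r) (w : Phase N) (x y : T3) :
    |rhoC r w x - rhoC r w y| ≤ 3 / (Real.pi * r ^ 4) * Torus.euclidDist x y ∧
    ‖momC r w x - momC r w y‖ ≤ 3 / (Real.pi * r ^ 4) * Torus.euclidDist x y *
        (1 / 2 + empiricalEnergyField w (fun _ => 1)) ∧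
    |kinC r w x - kinC r w y| ≤ 3 / (Real.pi * r ^ 4) * Torus.euclidDist x y *
        empiricalEnergyField w (fun _ => 1) :=
  empiricalFields_sub_le w (χ := fun x' => cone r x' y) (ψ := fun x' => cone r x' x) fun x' => by
    rw [show cone r x' x = cone r x x' from densMod_cone_comm r x x',
      show cone r x' y = cone r y x' from densMod_cone_comm r y x']
    exact gridUp_abs_cone_sub_cone_le hr x y x'

/-! ## The uniform law of large numbers at fixed `r` -/

/-- **Uniform-in-`x` law of large numbers for the cone fields at `t = 0`.** Under the `t = 0` tie
`TendstoHydroFieldsAt … 0` with continuous data `(ρ, u, θ)(0, ·)`: for all `ε, δ > 0` there is `r₀ > 0` such that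
for every `0 < r < r₀`, eventually in `N`, off an event of law-probability `≤ δ` the three cone fields of `Φ₀ z` are
`ε`-close to `(ρ, ρu, E)(0, x)` at EVERY centre `x`. (Finite net + centre-Lipschitz cone fields with energy-tight
constants + uniform continuity of the data + unit mass of the kernel.) -/
theorem initialLayer_uniformLLN :
  ∀ {σ : ℝ} {a₀ θ₀ : T3 → ℝ} {u₀ : T3 → V3} {ρ θ : ℝ → T3 → ℝ} {u : ℝ → T3 → V3},
    Continuous (ρ 0) → Continuous (u 0) → Continuous (θ 0) →
    ∀ Φ : (N : ℕ) → Flow σ N, TendstoHydroFieldsAt (fun N => localGibbsLaw σ a₀ u₀ θ₀ N (Φ N)) Φ ρ u θ 0 →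
    ∀ {ε δ : ℝ}, 0 < ε → 0 < δ → ∃ r₀ : ℝ, 0 < r₀ ∧ ∀ r : ℝ, 0 < r → r < r₀ → ∃ N₀ : ℕ, ∀ N : ℕ, N₀ ≤ N →
      ∃ B : Set (Phase N), localGibbsLaw σ a₀ u₀ θ₀ N (Φ N) B ≤ ENNReal.ofReal δ ∧
        ∀ z, z ∉ B → ∀ x : T3,
          |rhoC r ((Φ N).flow 0 z) x - ρ 0 x| < ε ∧
          ‖momC r ((Φ N).flow 0 z) x - ρ 0 x • u 0 x‖ < ε ∧
          |kinC r ((Φ N).flow 0 z) x - totalEnergyDensity (ρ 0 x) (u 0 x) (θ 0 x)| < ε := by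
  intro σ a₀ θ₀ u₀ ρ θ u hρc huc hθc Φ h0 ε δ hε hδ
  -- the data and their uniform continuity at scale `ε/4`
  have hEc : Continuous fun x => totalEnergyDensity (ρ 0 x) (u 0 x) (θ 0 x) := by
    unfold totalEnergyDensity; fun_prop
  have hMc : Continuous fun x => ρ 0 x • u 0 x := hρc.smul huc
  have hε4 : 0 < ε / 4 := by positivity
  obtain ⟨δ₁, hδ₁, H1⟩ := initL_unifCont hρc hε4
  obtain ⟨δ₂, hδ₂, H2⟩ := initL_unifCont hMc hε4
  obtain ⟨δ₃, hδ₃, H3⟩ := initL_unifCont hEc hε4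
  have hδD : 0 < min δ₁ (min δ₂ δ₃) := lt_min hδ₁ (lt_min hδ₂ hδ₃)
  have HD : ∀ x y : T3, Torus.euclidDist x y < min δ₁ (min δ₂ δ₃) →
      |ρ 0 x - ρ 0 y| < ε / 4 ∧ ‖ρ 0 x • u 0 x - ρ 0 y • u 0 y‖ < ε / 4 ∧
      |totalEnergyDensity (ρ 0 x) (u 0 x) (θ 0 x) - totalEnergyDensity (ρ 0 y) (u 0 y) (θ 0 y)| < ε / 4 :=
    fun x y hxy =>
      ⟨H1 x y (hxy.trans_le (min_le_left _ _)),
        H2 x y (hxy.trans_le ((min_le_right _ _).trans (min_le_left _ _))),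
        H3 x y (hxy.trans_le ((min_le_right _ _).trans (min_le_right _ _)))⟩
  refine ⟨min (min δ₁ (min δ₂ δ₃)) (1 / 2), lt_min hδD one_half_pos, fun r hr hrr₀ => ?_⟩
  have hrδ : r < min δ₁ (min δ₂ δ₃) := hrr₀.trans_le (min_le_left _ _)
  have hr2 : r ≤ 1 / 2 := (hrr₀.trans_le (min_le_right _ _)).le
  -- cone averages of the data are `ε/4`-close to the data, at every centre
  have HA : ∀ y : T3, |(∫ x, cone r x y * ρ 0 x) - ρ 0 y| ≤ ε / 4 ∧
      ‖(∫ x, (cone r x y * ρ 0 x) • u 0 x) - ρ 0 y • u 0 y‖ ≤ ε / 4 ∧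
      |(∫ x, cone r x y * totalEnergyDensity (ρ 0 x) (u 0 x) (θ 0 x)) -
        totalEnergyDensity (ρ 0 y) (u 0 y) (θ 0 y)| ≤ ε / 4 := by
    intro y
    refine ⟨initL_coneAvg hρc hr hr2 y fun x hx => (HD x y (hx.trans hrδ)).1.le, ?_,
      initL_coneAvg hEc hr hr2 y fun x hx => (HD x y (hx.trans hrδ)).2.2.le⟩
    have h : (fun x => (cone r x y * ρ 0 x) • u 0 x) = fun x => cone r x y • (ρ 0 x • u 0 x) := by
      funext x; rw [mul_smul]
    rw [h]
    exact initL_coneAvg hMc hr hr2 y fun x hx => (HD x y (hx.trans hrδ)).2.1.le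
  -- constants at fixed `r`, mesh, net
  set L : ℝ := 3 / (Real.pi * r ^ 4)
  have hLpos : 0 < L := by positivity
  set IE : ℝ := ∫ x, (1 : ℝ) * totalEnergyDensity (ρ 0 x) (u 0 x) (θ 0 x)
  set K : ℝ := |IE| + 1 with hK
  have hK1 : 1 ≤ K := by have := abs_nonneg IE; linarith
  have hL'pos : 0 < L * (1 + K) := by positivity
  set m : ℝ := min (min δ₁ (min δ₂ δ₃) / 2) (ε / (4 * (L * (1 + K))))
  have hmpos : 0 < m := lt_min (by positivity) (by positivity)
  have hmδ : m < min δ₁ (min δ₂ δ₃) := (min_le_left _ _).trans_lt (half_lt_self hδD)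
  have hmL : L * (1 + K) * m ≤ ε / 4 := by
    calc L * (1 + K) * m ≤ L * (1 + K) * (ε / (4 * (L * (1 + K)))) :=
          mul_le_mul_of_nonneg_left (min_le_right _ _) hL'pos.le
      _ = ε / 4 := by field_simp
  obtain ⟨Sx, hSx⟩ := gridUp_euclidNet hmpos
  -- the bad events
  set P : (N : ℕ) → Measure (Phase N) := fun N => localGibbsLaw σ a₀ u₀ θ₀ N (Φ N)
  set A1 : (N : ℕ) → T3 → Set (Phase N) := fun N y =>
    {z | ε / 4 < |empiricalDensityField ((Φ N).flow 0 z) (fun x => cone r x y) - ∫ x, cone r x y * ρ 0 x|}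
  set A2 : (N : ℕ) → T3 → Set (Phase N) := fun N y =>
    {z | ε / 4 < ‖empiricalMomentumField ((Φ N).flow 0 z) (fun x => cone r x y) -
      ∫ x, (cone r x y * ρ 0 x) • u 0 x‖}
  set A3 : (N : ℕ) → T3 → Set (Phase N) := fun N y =>
    {z | ε / 4 < |empiricalEnergyField ((Φ N).flow 0 z) (fun x => cone r x y) -
      ∫ x, cone r x y * totalEnergyDensity (ρ 0 x) (u 0 x) (θ 0 x)|}
  set AE : (N : ℕ) → Set (Phase N) := fun N =>
    {z | 1 < |empiricalEnergyField ((Φ N).flow 0 z) (fun _ => 1) - IE|}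
  have hA : ∀ y : T3, Tendsto (fun N => P N (A1 N y) + P N (A2 N y) + P N (A3 N y)) atTop (𝓝 0) := by
    intro y
    obtain ⟨h1, h2, h3⟩ := h0 (fun x => cone r x y) (densMod_continuous_cone r y) (ε / 4) hε4
    have h := (h1.add h2).add h3
    rw [add_zero, add_zero] at h
    exact h
  have hAE' : Tendsto (fun N => P N (AE N)) atTop (𝓝 0) :=
    (h0 (fun _ => (1 : ℝ)) continuous_const 1 one_pos).2.2
  set f : ℕ → ENNReal := fun N => (∑ y ∈ Sx, (P N (A1 N y) + P N (A2 N y) + P N (A3 N y))) + P N (AE N)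
  have hfT : Tendsto f atTop (𝓝 0) := by
    have hsum := tendsto_finsetSum Sx fun y (_ : y ∈ Sx) => hA y
    rw [Finset.sum_const_zero] at hsum
    simpa only [add_zero] using hsum.add hAE'
  obtain ⟨N₀, hN₀⟩ := eventually_atTop.1 ((tendsto_order.1 hfT).2 _ (ENNReal.ofReal_pos.2 hδ))
  refine ⟨N₀, fun N hN => ⟨(⋃ y ∈ Sx, (A1 N y ∪ A2 N y ∪ A3 N y)) ∪ AE N, ?_, ?_⟩⟩
  · calc P N ((⋃ y ∈ Sx, (A1 N y ∪ A2 N y ∪ A3 N y)) ∪ AE N)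
        ≤ P N (⋃ y ∈ Sx, (A1 N y ∪ A2 N y ∪ A3 N y)) + P N (AE N) := measure_union_le _ _
      _ ≤ (∑ y ∈ Sx, P N (A1 N y ∪ A2 N y ∪ A3 N y)) + P N (AE N) :=
          add_le_add (measure_biUnion_finset_le Sx _) le_rfl
      _ ≤ f N := by
          refine add_le_add (Finset.sum_le_sum fun y _ => ?_) le_rfl
          exact (measure_union_le _ _).trans (add_le_add (measure_union_le _ _) le_rfl)
      _ ≤ ENNReal.ofReal δ := (hN₀ N hN).le
  · intro z hz x
    have memU : ∀ y ∈ Sx, ∀ {S : T3 → Set (Phase N)}, z ∈ S y → z ∈ ⋃ y ∈ Sx, S y :=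
      fun y hy S h => Set.mem_iUnion.2 ⟨y, Set.mem_iUnion.2 ⟨hy, h⟩⟩
    obtain ⟨y, hy, hxy⟩ := hSx x
    set w := (Φ N).flow 0 z
    -- energy bound off `AE`
    have hEn : empiricalEnergyField w (fun _ => 1) ≤ K := by
      have h1 : ¬ (1 < |empiricalEnergyField w (fun _ => 1) - IE|) := fun h => hz (Or.inr h)
      have h2 := le_abs_self (empiricalEnergyField w (fun _ => 1) - IE)
      have h3 := le_abs_self IE
      rw [hK]; linarith [not_lt.1 h1]
    have hE0 := initL_energy_nonneg w
    -- the LLN at the net point `y`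
    have e1 : |rhoC r w y - ∫ x, cone r x y * ρ 0 x| ≤ ε / 4 :=
      not_lt.1 fun h => hz (Or.inl (memU y hy (S := fun y => A1 N y ∪ A2 N y ∪ A3 N y) (Or.inl (Or.inl h))))
    have e2 : ‖momC r w y - ∫ x, (cone r x y * ρ 0 x) • u 0 x‖ ≤ ε / 4 :=
      not_lt.1 fun h => hz (Or.inl (memU y hy (S := fun y => A1 N y ∪ A2 N y ∪ A3 N y) (Or.inl (Or.inr h))))
    have e3 : |kinC r w y - ∫ x, cone r x y * totalEnergyDensity (ρ 0 x) (u 0 x) (θ 0 x)| ≤ ε / 4 :=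
      not_lt.1 fun h => hz (Or.inl (memU y hy (S := fun y => A1 N y ∪ A2 N y ∪ A3 N y) (Or.inr h)))
    -- Lipschitz from `x` to the net point
    obtain ⟨l1, l2, l3⟩ := initL_fields_lip hr w x y
    have hd0 : 0 ≤ Torus.euclidDist x y := norm_nonneg _
    have hLd : L * Torus.euclidDist x y * (1 + K) ≤ ε / 4 :=
      le_trans (by nlinarith [mul_le_mul_of_nonneg_left hxy hLpos.le]) hmL
    have l1' : |rhoC r w x - rhoC r w y| ≤ ε / 4 := l1.trans (by nlinarith)
    have l2' : ‖momC r w x - momC r w y‖ ≤ ε / 4 := l2.trans (by nlinarith)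
    have l3' : |kinC r w x - kinC r w y| ≤ ε / 4 := l3.trans (by nlinarith)
    -- uniform continuity of the data from the net point back to `x`
    obtain ⟨d1, d2, d3⟩ := HD y x (by rw [Torus.euclidDist_comm]; exact hxy.trans_lt hmδ)
    obtain ⟨a1, a2, a3⟩ := HA y
    exact ⟨initL_chain_abs l1' e1 a1 d1, initL_chain l2' e2 a2 d2, initL_chain_abs l3' e3 a3 d3⟩

end Summit.AtomisticToContinuum.HydrodynamicLimit.Theorems.LocalSecondLawLedger

end
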